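import Summits.NavierStokesRegularity.NavierStokesRegularity.Theorems.RellichScarScarRigidityVorticityDefectDynamics
import Summits.NavierStokesRegularity.NavierStokesRegularity.Theorems.RellichScarScarRigidityVorticityDefectBounds
import HarnessLib

/-!
# `ScarRigidity`, line `moment-conditioned-rellich` — stub `stub_paintedLadderHigher` (PL≥2), part 1:
# the time-integration step of one rung of the painted ladder

Crux stmt-NavierStokesRegularity-11717 (route RellichScar), helper file (`--supports`) for the registered stub
`stub_paintedLadderHigher` (skeleton `Cruxes/ScarRigidity/Lines/moment_conditioned_rellich.lean`).

One rung of the painted ladder climbs from flatness of order `N + 2` of the twin difference `w = V₁ − V₂` on the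
parabolic exterior `√(−t) ≤ ‖x‖` to flatness of order `N + 3`.  The difference of the two momentum equations is
`∂ₜw = G − ∇π`, `G = Δw − ((w·∇)V₁ + (V₂·∇)w)`, `π = Q₁ − Q₂` (`deriv_twinDiff_eq`, part 2 of the vorticity rung),
so at every spatial order `∂ₜDᵏw(s,x) = DᵏG(s,x) − Dᵏ(∇π(s))(x)` (`hasDerivAt_iteratedFDeriv_twinDiff`).  On the
exterior, flatness of order `N + 2` and the scale-invariant packages bound the bracket one order better than
needed, `‖DᵏG(s,x)‖ ≤ c (√(−s))^{N+1}/‖x‖^{N+4+k}` (`exists_defectSource_exterior_bound`, the pointwise Leibniz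
bound `norm_iteratedFDeriv_defectSource_le` of part 1 of the vorticity rung at the length `ρ = ‖x‖`).  HENCE
(`farDecay_succ_of_pressureGradient_bound`, the theorem of this file): **if the pressure gradient is painted at the
right order, `‖Dᵏ⁺¹(Q₁ − Q₂)(s,x)‖ ≤ P (√(−s))^N/‖x‖^{N+3+k}` on the exterior, then `FarDecay (N + 3) V₁ V₂`** —
integrate `‖∂ₜDᵏw(s,x)‖ ≤ (c + P)(√(−t))^N/‖x‖^{N+3+k}` on `s ∈ [t, 0)` back from the final slice, where all
derivatives of `w` vanish off the apex (global cubic flatness, `tendsto_iteratedFDeriv_twinDiff`), to get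
`‖Dᵏw(t,x)‖ ≤ (c + P)(√(−t))^{N+2}/‖x‖^{N+3+k} = (c + P)(√(−t))⁻¹(√(−t)/‖x‖)^{N+3}/‖x‖ᵏ`.

What is NOT here: the far-field (multipole) expansion of `∇(Q₁ − Q₂) = ∇ℛᵢℛⱼ(V₁⊗V₁ − V₂⊗V₂)ᵢⱼ` which produces
the hypothesis from the vanishing of the radiative moments (parts 2ff.).
-/

noncomputable section

open Set Filter Function MeasureTheory Metric TopologicalSpace
open scoped Topology ContDiff Laplacian InnerProductSpace RealInnerProductSpace
open Literature.Analysis.FluidPDE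

set_option linter.dupNamespace false -- D-0017: `Summit.<S>.<S>.…` repeats the summit name by design

-- nested operator types
set_option maxSynthPendingDepth 4

namespace Summit.NavierStokesRegularity.NavierStokesRegularity.Theorems.RellichScarScarRigidity

variable {V₁ V₂ : ℝ → EuclideanSpace ℝ (Fin 3) → EuclideanSpace ℝ (Fin 3)}
  {Q₁ Q₂ : ℝ → EuclideanSpace ℝ (Fin 3) → ℝ}

/-! ### Flatness of order `N` with one constant, in power form -/

/-- The power form of the flatness weight: `K σ⁻¹ (σ/a)^N / aᵇ = K σ⁻¹ σ^N / a^{N+b}`. [folklore] -/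
theorem farDecay_weight_eq (K : ℝ) {σ a : ℝ} (ha : 0 < a) (N b : ℕ) :
    K * σ⁻¹ * (σ / a) ^ N / a ^ b = K * σ⁻¹ * σ ^ N / a ^ (N + b) := by
  rw [div_pow, pow_add]
  field_simp

/-- **Flatness of order `N` with one constant for all orders `b ≤ M`**, in the power form
`‖Dᵇ(V₁ − V₂)(t,x)‖ ≤ K (√(−t))⁻¹ (√(−t))^N / ‖x‖^{N+b}` on the parabolic exterior. [folklore] -/
theorem farDecay_uniform (N : ℕ) (h : FarDecay N V₁ V₂) (M : ℕ) :
    ∃ K : ℝ, 0 ≤ K ∧ ∀ b ≤ M, ∀ t < 0, ∀ x : EuclideanSpace ℝ (Fin 3), Real.sqrt (-t) ≤ ‖x‖ →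
      ‖iteratedFDeriv ℝ b (fun y => V₁ t y - V₂ t y) x‖ ≤
        K * (Real.sqrt (-t))⁻¹ * Real.sqrt (-t) ^ N / ‖x‖ ^ (N + b) := by
  refine exists_forall_le_of_forall_exists (P := fun b K => ∀ t < 0, ∀ x : EuclideanSpace ℝ (Fin 3),
      Real.sqrt (-t) ≤ ‖x‖ → ‖iteratedFDeriv ℝ b (fun y => V₁ t y - V₂ t y) x‖ ≤
        K * (Real.sqrt (-t))⁻¹ * Real.sqrt (-t) ^ N / ‖x‖ ^ (N + b))
    (fun n K K' hKK' hP t ht x hx => ?_) (fun n => ?_) M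
  · have hσ : 0 < Real.sqrt (-t) := Real.sqrt_pos.2 (by linarith)
    have hxpos : 0 < ‖x‖ := hσ.trans_le hx
    refine (hP t ht x hx).trans (div_le_div_of_nonneg_right ?_ (pow_nonneg hxpos.le _))
    exact mul_le_mul_of_nonneg_right (mul_le_mul_of_nonneg_right hKK' (inv_nonneg.2 hσ.le)) (pow_nonneg hσ.le _)
  · obtain ⟨K, hK⟩ := h n
    refine ⟨K, fun t ht x hx => ?_⟩
    have hσ : 0 < Real.sqrt (-t) := Real.sqrt_pos.2 (by linarith)
    have hxpos : 0 < ‖x‖ := hσ.trans_le hx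
    rw [← farDecay_weight_eq K hxpos N n]
    exact hK t ht x hx

/-! ### The defect source on the parabolic exterior under flatness of order `N + 2` -/

/-- **The defect source on the exterior, one order better.**  Under the scale-invariant packages and flatness of
order `N + 2`, for every `k` there is `c ≥ 0` with
`‖DᵏG(s,x)‖ ≤ c (√(−s))⁻¹ (√(−s))^{N+2} / ‖x‖^{N+4+k}` for `s < 0`, `√(−s) ≤ ‖x‖`, where
`G = Δw − ((w·∇)V₁ + (V₂·∇)w)`, `w = V₁(s) − V₂(s)` (the Leibniz bound `norm_iteratedFDeriv_defectSource_le` at the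
length `ρ = ‖x‖`, with `‖DᵇVᵢ(s,x)‖ ≤ L/(‖x‖+√(−s))^{1+b} ≤ L/‖x‖^{1+b}`). [folklore] -/
theorem exists_defectSource_exterior_bound (hcl₁ : IsClassicalNSSolutionOn (Iio (0 : ℝ)) 1 0 V₁ Q₁)
    (hcl₂ : IsClassicalNSSolutionOn (Iio (0 : ℝ)) 1 0 V₂ Q₂) (hB₁ : ScaleInvariantBounds V₁ Q₁)
    (hB₂ : ScaleInvariantBounds V₂ Q₂) (N : ℕ) (hF : FarDecay (N + 2) V₁ V₂) (k : ℕ) :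
    ∃ c : ℝ, 0 ≤ c ∧ ∀ s < 0, ∀ x : EuclideanSpace ℝ (Fin 3), Real.sqrt (-s) ≤ ‖x‖ →
      ‖iteratedFDeriv ℝ k (fun y => Δ (fun z => V₁ s z - V₂ s z) y -
          (convect (fun z => V₁ s z - V₂ s z) (V₁ s) y + convect (V₂ s) (fun z => V₁ s z - V₂ s z) y)) x‖ ≤
        c * (Real.sqrt (-s))⁻¹ * Real.sqrt (-s) ^ (N + 2) / ‖x‖ ^ (N + 4 + k) := by
  obtain ⟨K, hK0, hK⟩ := farDecay_uniform (N + 2) hF (k + 2)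
  obtain ⟨L, hL0, hL⟩ := exists_twin_velocity_bounds hB₁ hB₂ (k + 1)
  refine ⟨(3 + 2 ^ (k + 1) * L) * K, by positivity, fun s hs x hx => ?_⟩
  have hσ : 0 < Real.sqrt (-s) := Real.sqrt_pos.2 (by linarith)
  have hxpos : 0 < ‖x‖ := hσ.trans_le hx
  have hw : ContDiff ℝ ∞ (fun z => V₁ s z - V₂ s z) := (hcl₁.contDiff_velocity hs).sub (hcl₂.contDiff_velocity hs)
  -- the velocity bounds at the length `‖x‖`
  have hV : ∀ b ≤ k + 1, ‖iteratedFDeriv ℝ b (V₁ s) x‖ ≤ L / ‖x‖ ^ (1 + b) ∧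
      ‖iteratedFDeriv ℝ b (V₂ s) x‖ ≤ L / ‖x‖ ^ (1 + b) := by
    intro b hb
    have hρ : ‖x‖ ^ (1 + b) ≤ (‖x‖ + Real.sqrt (-s)) ^ (1 + b) :=
      pow_le_pow_left₀ hxpos.le (le_add_of_nonneg_right hσ.le) _
    have h1 := hL b hb s hs x
    exact ⟨h1.1.trans (div_le_div_of_nonneg_left hL0 (pow_pos hxpos _) hρ),
      h1.2.trans (div_le_div_of_nonneg_left hL0 (pow_pos hxpos _) hρ)⟩
  have hA0 : 0 ≤ K * (Real.sqrt (-s))⁻¹ * Real.sqrt (-s) ^ (N + 2) := by positivity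
  have h := norm_iteratedFDeriv_defectSource_le hw (hcl₁.contDiff_velocity hs) (hcl₂.contDiff_velocity hs)
    (n := k) (p := N + 2) (ρ := ‖x‖) (A := K * (Real.sqrt (-s))⁻¹ * Real.sqrt (-s) ^ (N + 2)) (B := L)
    hxpos hA0 hL0 (fun b hb => hK b hb s hs x hx) (fun b hb => (hV b hb).1) (fun b hb => (hV b hb).2)
  rw [show N + 2 + 2 + k = N + 4 + k by ring] at h
  refine h.trans (le_of_eq ?_)
  ring

/-! ### The time derivative of the spatial derivatives of the twin difference -/

/-- **`∂ₜDᵏw = DᵏG − Dᵏ(∇Q₁ − ∇Q₂)`** for the twin difference `w = V₁ − V₂` at every `s < 0` and every `x`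
(exchange of `∂ₜ` and `Dᵏ` for the jointly smooth `w`, and the difference of the momentum equations
`deriv_twinDiff_eq`). [folklore] -/
theorem hasDerivAt_iteratedFDeriv_twinDiff (hcl₁ : IsClassicalNSSolutionOn (Iio (0 : ℝ)) 1 0 V₁ Q₁)
    (hcl₂ : IsClassicalNSSolutionOn (Iio (0 : ℝ)) 1 0 V₂ Q₂) (k : ℕ) {s : ℝ} (hs : s < 0)
    (x : EuclideanSpace ℝ (Fin 3)) :
    HasDerivAt (fun σ => iteratedFDeriv ℝ k (fun y => V₁ σ y - V₂ σ y) x)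
      (iteratedFDeriv ℝ k (fun y => Δ (fun z => V₁ s z - V₂ s z) y -
          (convect (fun z => V₁ s z - V₂ s z) (V₁ s) y + convect (V₂ s) (fun z => V₁ s z - V₂ s z) y)) x -
        iteratedFDeriv ℝ k (fun y => gradient (Q₁ s) y - gradient (Q₂ s) y) x) s := by
  have hw := isSmoothSpaceTimeOn_twinDiff hcl₁ hcl₂
  have h := hasDerivAt_iteratedFDeriv_slice hw isOpen_Iio k s hs x
  have e : (fun y => deriv (fun σ => V₁ σ y - V₂ σ y) s) = fun y =>
      (Δ (fun z => V₁ s z - V₂ s z) y -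
          (convect (fun z => V₁ s z - V₂ s z) (V₁ s) y + convect (V₂ s) (fun z => V₁ s z - V₂ s z) y)) -
        (gradient (Q₁ s) y - gradient (Q₂ s) y) := funext fun y => deriv_twinDiff_eq hcl₁ hcl₂ hs y
  rw [e] at h
  have hG := contDiff_defectSource_slice hcl₁ hcl₂ hs
  have hg : ContDiff ℝ ∞ fun y => gradient (Q₁ s) y - gradient (Q₂ s) y :=
    (contDiff_gradient_top (hcl₁.contDiff_pressure hs)).sub (contDiff_gradient_top (hcl₂.contDiff_pressure hs))
  have hk : ((k : ℕ∞) : WithTop ℕ∞) ≤ ∞ := by exact_mod_cast le_top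
  rw [fun_iteratedFDeriv_sub_apply (hG.of_le hk).contDiffAt (hg.of_le hk).contDiffAt] at h
  exact h

/-- `‖Dᵏ(∇Q₁(s) − ∇Q₂(s))(x)‖ = ‖Dᵏ⁺¹(Q₁(s) − Q₂(s))(x)‖` for the smooth pressures. [folklore] -/
theorem norm_iteratedFDeriv_gradient_sub (hcl₁ : IsClassicalNSSolutionOn (Iio (0 : ℝ)) 1 0 V₁ Q₁)
    (hcl₂ : IsClassicalNSSolutionOn (Iio (0 : ℝ)) 1 0 V₂ Q₂) (k : ℕ) {s : ℝ} (hs : s < 0)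
    (x : EuclideanSpace ℝ (Fin 3)) :
    ‖iteratedFDeriv ℝ k (fun y => gradient (Q₁ s) y - gradient (Q₂ s) y) x‖ =
      ‖iteratedFDeriv ℝ (k + 1) (fun y => Q₁ s y - Q₂ s y) x‖ := by
  have hQ₁ : ContDiff ℝ ∞ (Q₁ s) := hcl₁.contDiff_pressure hs
  have hQ₂ : ContDiff ℝ ∞ (Q₂ s) := hcl₂.contDiff_pressure hs
  have e : (fun y => gradient (Q₁ s) y - gradient (Q₂ s) y) = gradient (fun y => Q₁ s y - Q₂ s y) := by
    funext y
    have h1 : DifferentiableAt ℝ (Q₁ s) y := hQ₁.differentiable (by simp) y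
    have h2 : DifferentiableAt ℝ (Q₂ s) y := hQ₂.differentiable (by simp) y
    rw [gradient, gradient, gradient, fderiv_fun_sub h1 h2, map_sub]
  rw [e, norm_iteratedFDeriv_gradient]

/-! ### The slice limit -/

/-- **All spatial derivatives of the twin difference vanish at the final slice off the apex**:
`Dᵏ(V₁ − V₂)(s,x) → 0` as `s ↑ 0` for `x ≠ 0` (global cubic flatness `‖Dᵏw(s,x)‖ ≤ W(−s)/‖x‖^{3+k}`). [folklore] -/
theorem tendsto_iteratedFDeriv_twinDiff (hcl₁ : IsClassicalNSSolutionOn (Iio (0 : ℝ)) 1 0 V₁ Q₁)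
    (hcl₂ : IsClassicalNSSolutionOn (Iio (0 : ℝ)) 1 0 V₂ Q₂) (hB₁ : ScaleInvariantBounds V₁ Q₁)
    (hB₂ : ScaleInvariantBounds V₂ Q₂) (hF : FarDecay 3 V₁ V₂) (k : ℕ) {x : EuclideanSpace ℝ (Fin 3)}
    (hx : x ≠ 0) :
    Tendsto (fun s => iteratedFDeriv ℝ k (fun y => V₁ s y - V₂ s y) x) (𝓝[<] (0 : ℝ)) (𝓝 0) := by
  obtain ⟨W, hW0, hW⟩ :=
    exists_global_cubic_flatness hcl₁.smooth_velocity hcl₂.smooth_velocity hB₁ hB₂ hF k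
  have hxpos : 0 < ‖x‖ := norm_pos_iff.2 hx
  have hxk : 0 < ‖x‖ ^ (3 + k) := pow_pos hxpos _
  rw [tendsto_zero_iff_norm_tendsto_zero]
  have hbound : ∀ᶠ s in 𝓝[<] (0 : ℝ),
      ‖iteratedFDeriv ℝ k (fun y => V₁ s y - V₂ s y) x‖ ≤ W * (-s) / ‖x‖ ^ (3 + k) := by
    filter_upwards [self_mem_nhdsWithin] with s hs
    have hs' : s < 0 := hs
    have hρ : ‖x‖ ^ (3 + k) ≤ (‖x‖ + Real.sqrt (-s)) ^ (3 + k) :=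
      pow_le_pow_left₀ hxpos.le (le_add_of_nonneg_right (Real.sqrt_nonneg _)) _
    exact (hW k le_rfl s hs' x).trans
      (div_le_div_of_nonneg_left (mul_nonneg hW0 (by linarith)) hxk hρ)
  have hlim : Tendsto (fun s : ℝ => W * (-s) / ‖x‖ ^ (3 + k)) (𝓝[<] (0 : ℝ)) (𝓝 0) := by
    have hc : Continuous fun s : ℝ => W * (-s) / ‖x‖ ^ (3 + k) :=
      ((continuous_const.mul continuous_neg).div_const _)
    have := hc.tendsto 0
    rw [neg_zero, mul_zero, zero_div] at this
    exact this.mono_left nhdsWithin_le_nhds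
  exact squeeze_zero' (Eventually.of_forall fun s => norm_nonneg _) hbound hlim

/-! ### One rung: time integration -/

/-- The closing algebra of a rung: `M σ² = M' σ⁻¹ (σ/a)^{N+3} / aᵏ` with `M = M' σ^N/a^{N+3+k}`. [folklore] -/
theorem rung_algebra (M : ℝ) {σ a : ℝ} (hσ : 0 < σ) (ha : 0 < a) (N k : ℕ) :
    M * σ ^ N / a ^ (N + 3 + k) * σ ^ 2 = M * σ⁻¹ * (σ / a) ^ (N + 3) / a ^ k := by
  rw [div_pow, pow_add a (N + 3) k]
  field_simp
  ring

/-- **One rung of the painted ladder, given the painted pressure gradient.**  For two classical Navier–Stokes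
pairs on the open backward slab with the scale-invariant packages, cubic flatness and flatness of order `N + 2`
of the difference, IF the pressure gradient is flat at the next order on the parabolic exterior —
`‖Dᵏ⁺¹(Q₁(s) − Q₂(s))(x)‖ ≤ P (√(−s))^N/‖x‖^{N+3+k}` for `√(−s) ≤ ‖x‖`, every `k` — then the pair is flat of
order `N + 3`: `∂ₜDᵏw = DᵏG − Dᵏ⁺¹π` with `‖DᵏG‖ ≤ c(√(−s))^{N+1}/‖x‖^{N+4+k} ≤ c(√(−s))^N/‖x‖^{N+3+k}` on the
exterior, and integration on `[t, 0)` back from the final slice (where `Dᵏw(·,x) → 0`) gives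
`‖Dᵏw(t,x)‖ ≤ (c + P)(√(−t))^{N+2}/‖x‖^{N+3+k}`. [folklore] -/
theorem farDecay_succ_of_pressureGradient_bound (hcl₁ : IsClassicalNSSolutionOn (Iio (0 : ℝ)) 1 0 V₁ Q₁)
    (hcl₂ : IsClassicalNSSolutionOn (Iio (0 : ℝ)) 1 0 V₂ Q₂) (hB₁ : ScaleInvariantBounds V₁ Q₁)
    (hB₂ : ScaleInvariantBounds V₂ Q₂) (hF3 : FarDecay 3 V₁ V₂) (N : ℕ) (hFN : FarDecay (N + 2) V₁ V₂)
    (hπ : ∀ k : ℕ, ∃ P : ℝ, ∀ s < 0, ∀ x : EuclideanSpace ℝ (Fin 3), Real.sqrt (-s) ≤ ‖x‖ →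
      ‖iteratedFDeriv ℝ (k + 1) (fun y => Q₁ s y - Q₂ s y) x‖ ≤ P * Real.sqrt (-s) ^ N / ‖x‖ ^ (N + 3 + k)) :
    FarDecay (N + 3) V₁ V₂ := by
  intro k
  obtain ⟨c, hc0, hc⟩ := exists_defectSource_exterior_bound hcl₁ hcl₂ hB₁ hB₂ N hFN k
  obtain ⟨P, hP⟩ := hπ k
  refine ⟨c + max P 0, fun t ht x hx => ?_⟩
  have hσ : 0 < Real.sqrt (-t) := Real.sqrt_pos.2 (by linarith)
  have hnt : 0 < -t := by linarith
  have hxpos : 0 < ‖x‖ := hσ.trans_le hx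
  have hP0 : 0 ≤ max P 0 := le_max_right _ _
  -- the uniform bound on the rate along `s ∈ [t, 0)`
  set M : ℝ := (c + max P 0) * Real.sqrt (-t) ^ N / ‖x‖ ^ (N + 3 + k) with hM
  have hM0 : 0 ≤ M := by positivity
  have hrate : ∀ s ∈ Ico t 0,
      ‖iteratedFDeriv ℝ k (fun y => Δ (fun z => V₁ s z - V₂ s z) y -
            (convect (fun z => V₁ s z - V₂ s z) (V₁ s) y + convect (V₂ s) (fun z => V₁ s z - V₂ s z) y)) x -
          iteratedFDeriv ℝ k (fun y => gradient (Q₁ s) y - gradient (Q₂ s) y) x‖ ≤ M := by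
    intro s hs
    have hs0 : s < 0 := hs.2
    have hσs : 0 < Real.sqrt (-s) := Real.sqrt_pos.2 (by linarith)
    have hst : Real.sqrt (-s) ≤ Real.sqrt (-t) := Real.sqrt_le_sqrt (by linarith [hs.1])
    have hsx : Real.sqrt (-s) ≤ ‖x‖ := hst.trans hx
    have h1 := hc s hs0 x hsx
    have h2 := hP s hs0 x hsx
    rw [← norm_iteratedFDeriv_gradient_sub hcl₁ hcl₂ k hs0 x] at h2
    have hpowN : Real.sqrt (-s) ^ N ≤ Real.sqrt (-t) ^ N := pow_le_pow_left₀ hσs.le hst N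
    have hxk : 0 < ‖x‖ ^ (N + 3 + k) := pow_pos hxpos _
    -- the source term: `c σ⁻¹ σ^{N+2}/‖x‖^{N+4+k} ≤ c σ_t^N/‖x‖^{N+3+k}`
    have h1' : c * (Real.sqrt (-s))⁻¹ * Real.sqrt (-s) ^ (N + 2) / ‖x‖ ^ (N + 4 + k) ≤
        c * Real.sqrt (-t) ^ N / ‖x‖ ^ (N + 3 + k) := by
      have e1 : c * (Real.sqrt (-s))⁻¹ * Real.sqrt (-s) ^ (N + 2) / ‖x‖ ^ (N + 4 + k) =
          c * Real.sqrt (-s) ^ N / ‖x‖ ^ (N + 3 + k) * (Real.sqrt (-s) / ‖x‖) := by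
        rw [show N + 4 + k = (N + 3 + k) + 1 by ring, pow_succ, pow_add]
        field_simp
        ring
      rw [e1]
      have hq : Real.sqrt (-s) / ‖x‖ ≤ 1 := (div_le_one hxpos).2 hsx
      calc c * Real.sqrt (-s) ^ N / ‖x‖ ^ (N + 3 + k) * (Real.sqrt (-s) / ‖x‖)
          ≤ c * Real.sqrt (-s) ^ N / ‖x‖ ^ (N + 3 + k) * 1 :=
            mul_le_mul_of_nonneg_left hq (by positivity)
        _ ≤ c * Real.sqrt (-t) ^ N / ‖x‖ ^ (N + 3 + k) := by
            rw [mul_one]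
            exact div_le_div_of_nonneg_right (mul_le_mul_of_nonneg_left hpowN hc0) hxk.le
    -- the pressure term
    have h2' : P * Real.sqrt (-s) ^ N / ‖x‖ ^ (N + 3 + k) ≤ max P 0 * Real.sqrt (-t) ^ N / ‖x‖ ^ (N + 3 + k) := by
      refine div_le_div_of_nonneg_right ?_ hxk.le
      exact (mul_le_mul_of_nonneg_right (le_max_left _ _) (pow_nonneg hσs.le _)).trans
        (mul_le_mul_of_nonneg_left hpowN hP0)
    calc _ ≤ ‖iteratedFDeriv ℝ k (fun y => Δ (fun z => V₁ s z - V₂ s z) y -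
              (convect (fun z => V₁ s z - V₂ s z) (V₁ s) y + convect (V₂ s) (fun z => V₁ s z - V₂ s z) y)) x‖ +
            ‖iteratedFDeriv ℝ k (fun y => gradient (Q₁ s) y - gradient (Q₂ s) y) x‖ := norm_sub_le _ _
      _ ≤ c * Real.sqrt (-t) ^ N / ‖x‖ ^ (N + 3 + k) + max P 0 * Real.sqrt (-t) ^ N / ‖x‖ ^ (N + 3 + k) :=
          add_le_add (h1.trans h1') (h2.trans h2')
      _ = M := by rw [hM]; ring
  have hmain := norm_le_of_hasDerivAt_of_tendsto_zero (g := fun σ => iteratedFDeriv ℝ k (fun y => V₁ σ y - V₂ σ y) x)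
    ht hM0 (fun s hs => hasDerivAt_iteratedFDeriv_twinDiff hcl₁ hcl₂ k hs.2 x) hrate
    (tendsto_iteratedFDeriv_twinDiff hcl₁ hcl₂ hB₁ hB₂ hF3 k (norm_pos_iff.1 hxpos))
  calc ‖iteratedFDeriv ℝ k (fun y => V₁ t y - V₂ t y) x‖ ≤ M * (-t) := hmain
    _ = M * Real.sqrt (-t) ^ 2 := by rw [Real.sq_sqrt hnt.le]
    _ = (c + max P 0) * (Real.sqrt (-t))⁻¹ * (Real.sqrt (-t) / ‖x‖) ^ (N + 3) / ‖x‖ ^ k := by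
        rw [hM]
        exact rung_algebra (c + max P 0) hσ hxpos N k

/-! ### Registered sub-goal -/

/-- **Registered helper stub `stub_paintedLadderTimeStepTools`** of `stub_paintedLadderHigher` (crux
stmt-NavierStokesRegularity-11717, line `moment-conditioned-rellich`): the exterior bound on the defect source under
flatness of order `N + 2`, and one rung of the painted ladder given the painted pressure gradient
(`FarDecay (N + 3)` from `FarDecay (N + 2)` and `‖Dᵏ⁺¹(Q₁ − Q₂)‖ ≤ P(√(−s))^N/‖x‖^{N+3+k}` on the exterior). [folklore] -/
theorem stub_paintedLadderTimeStepTools :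
    (∀ (V₁ V₂ : ℝ → EuclideanSpace ℝ (Fin 3) → EuclideanSpace ℝ (Fin 3)) (Q₁ Q₂ : ℝ → EuclideanSpace ℝ (Fin 3) → ℝ), IsClassicalNSSolutionOn (Iio (0 : ℝ)) 1 0 V₁ Q₁ → IsClassicalNSSolutionOn (Iio (0 : ℝ)) 1 0 V₂ Q₂ → ScaleInvariantBounds V₁ Q₁ → ScaleInvariantBounds V₂ Q₂ → ∀ N : ℕ, FarDecay (N + 2) V₁ V₂ → ∀ k : ℕ, ∃ c : ℝ, 0 ≤ c ∧ ∀ s < 0, ∀ x : EuclideanSpace ℝ (Fin 3), Real.sqrt (-s) ≤ ‖x‖ → ‖iteratedFDeriv ℝ k (fun y => Laplacian.laplacian (fun z => V₁ s z - V₂ s z) y - (convect (fun z => V₁ s z - V₂ s z) (V₁ s) y + convect (V₂ s) (fun z => V₁ s z - V₂ s z) y)) x‖ ≤ c * (Real.sqrt (-s))⁻¹ * Real.sqrt (-s) ^ (N + 2) / ‖x‖ ^ (N + 4 + k)) ∧ (∀ (V₁ V₂ : ℝ → EuclideanSpace ℝ (Fin 3) → EuclideanSpace ℝ (Fin 3))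 (Q₁ Q₂ : ℝ → EuclideanSpace ℝ (Fin 3) → ℝ), IsClassicalNSSolutionOn (Iio (0 : ℝ)) 1 0 V₁ Q₁ → IsClassicalNSSolutionOn (Iio (0 : ℝ)) 1 0 V₂ Q₂ → ScaleInvariantBounds V₁ Q₁ → ScaleInvariantBounds V₂ Q₂ → FarDecay 3 V₁ V₂ → ∀ N : ℕ, FarDecay (N + 2) V₁ V₂ → (∀ k : ℕ, ∃ P : ℝ, ∀ s < 0, ∀ x : EuclideanSpace ℝ (Fin 3), Real.sqrt (-s) ≤ ‖x‖ → ‖iteratedFDeriv ℝ (k + 1) (fun y => Q₁ s y - Q₂ s y) x‖ ≤ P * Real.sqrt (-s) ^ N / ‖x‖ ^ (N + 3 + k)) → FarDecay (N + 3) V₁ V₂) :=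
  ⟨fun _V₁ _V₂ _Q₁ _Q₂ hcl₁ hcl₂ hB₁ hB₂ N hFN k => exists_defectSource_exterior_bound hcl₁ hcl₂ hB₁ hB₂ N hFN k,
    fun _V₁ _V₂ _Q₁ _Q₂ hcl₁ hcl₂ hB₁ hB₂ hF3 N hFN hπ =>
      farDecay_succ_of_pressureGradient_bound hcl₁ hcl₂ hB₁ hB₂ hF3 N hFN hπ⟩

end Summit.NavierStokesRegularity.NavierStokesRegularity.Theorems.RellichScarScarRigidity

end
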